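import Summits.CriticalPhenomena.PercolationContinuityZ3.Theorems.PercNearOneGluingNoHeavyLowerTailSunflowerParityLemma
import Mathlib.LinearAlgebra.Matrix.NonsingularInverse
import HarnessLib

/-!
# `NoHeavyLowerTail` (crux stmt-CriticalPhenomena-4575), hull-port line hp-7: SUNFLOWER–KLEITMAN (W-Λ) for acyclic orientations, I —
# the transposed parity lemma `Δ·Γ = I` and the same-head Gram identity (F1)

Support file (prover `prim-hp-7`, generation 49; `--supports stmt-CriticalPhenomena-4575`).  Pure finite combinatorics / linear algebra over `ZMod 2`;
no definitions, no `sorry`, standard axioms.  Memo: `prim-hp-7/FROM-prim-hp-7-g49-WLAMBDA-ACYCLIC.md`.  Part 1 of 3 (`…Gram`, `…Cross`, `…Acyclic`).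

SETTING (all three files).  A monotone labelling of the cube `2^α` by `⊤` (the up-set `K`), `⊥` (the down-set `D`, disjoint from `K`) and
finitely many middle labels, encoded by a rank function `ρ` that is constant along inclusions inside the middle zone (`hρ`): the classes
`{x ∉ K ∪ D : ρ x = c}` are the PETALS of a sunflower of up-sets `G_c = K ∪ petal_c` with kernel `K` (memo g48 §2: "sunflower–Kleitman" = hp-7's
W-Λ rows = an increasing-injection form of Gladkov's strong Harris–Kleitman inequality).  SOURCES: `ζ` with `ζ, univ∖ζ` both middle and
`ρ ζ < ρ (univ∖ζ)` (an oriented pair of distinct petals, the orientation being ACYCLIC = along `ρ`); TARGETS: `ζ ∈ K` with `univ∖ζ ∈ D`.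
THE THEOREM (file `…Acyclic`, `JBern.card_filter_source_le_card_filter_target`): for every up-set `𝒰`, `#(sources ∩ 𝒰) ≤ #(targets ∩ 𝒰)`.
METHOD: the `sources × targets` matrix `A[s,t] = #{C ∈ G_{ρ(univ∖s)} : univ∖t ⊆ C ⊆ univ∖s} (mod 2)` is supported on `s ⊆ t` and has FULL ROW
RANK over `GF(2)`; pairing its rows with the test vectors `y_{s₀}[t] = #{R : univ∖t ⊆ R ⊆ univ∖s₀, univ∖R ∈ G_{ρ(univ∖s₀)}}` gives the Gram
entries `[s = s₀]` for sources with the same head (F1, this file: prim-l12-p2's parity lemma `Ξ² = I`, `HallGladkov.gam_del_sum`, transposed through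
`mul_eq_one_comm`, plus the vanishing of the rows off the target columns) and `0` for different heads unless `ρ s₀ = ρ(univ∖s)` (F2, file `…Cross`);
so a vanishing combination of rows dies along `ρ` (file `…Acyclic`), and rows inside an up-set being supported on columns inside it, the counting
inequality is a `finrank` comparison. [this work]
-/

namespace Summit.CriticalPhenomena.PercolationContinuityZ3.Theorems.JBern

open Finset
open Summit.CriticalPhenomena.PercolationContinuityZ3.Theorems.SunflowerPartition.HallGladkov

variable {α : Type*} [Fintype α] [DecidableEq α]

/-! ## 1. The transposed parity lemma `Δ·Γ = I` -/

/-- `a ∈ IN(G)` iff `univ \ a ∈ OUT(G)` (inside the full cube). [this work] -/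
theorem sdiff_mem_outV_of_mem_inV {G : Finset (Finset α)} {a : Finset α} (ha : a ∈ inV G univ) : univ \ a ∈ outV G univ := by
  unfold inV at ha; unfold outV
  rw [mem_filter, mem_powerset] at ha ⊢
  refine ⟨sdiff_subset, ?_, ?_⟩
  · exact ha.2.2
  · rw [Finset.sdiff_sdiff_eq_self (subset_univ a)]; exact ha.2.1

/-- **`Δ·Γ = I`** (this work): for an up-set `G` of the full cube and `S, S″ ∈ IN(G)`,
`Σ_{a ∈ IN(G)} δ(S, univ∖a)·γ(univ∖a, S″) = [S = S″]` over `GF(2)`, where `δ(S,T″) = #{C ∈ G : T″ ⊆ C ⊆ S}` and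
`γ(T,S″) = #{R : T ⊆ R ⊆ S″, univ∖R ∈ G}` — the parity lemma `Γ·Δ = I` of prim-l12-p2 (`HallGladkov.gam_del_sum`) transposed, the two
square matrices being indexed by `IN(G) ≃ OUT(G)`. [this work] -/
theorem del_gam_sum {G : Finset (Finset α)} (hG : IsUpperSet (G : Set (Finset α)))
    {S S'' : Finset α} (hS : S ∈ inV G univ) (hS'' : S'' ∈ inV G univ) :
    (∑ a ∈ inV G univ,
        (∑ C ∈ (univ : Finset α).powerset, (if C ∈ G ∧ univ \ a ⊆ C ∧ C ⊆ S then (1 : ZMod 2) else 0)) *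
        (∑ R ∈ (univ : Finset α).powerset, (if univ \ a ⊆ R ∧ R ⊆ S'' ∧ univ \ R ∈ G then (1 : ZMod 2) else 0)))
      = if S = S'' then 1 else 0 := by
  classical
  set J := inV G (univ : Finset α) with hJ
  let Γm : Matrix J J (ZMod 2) := fun a b =>
    ∑ R ∈ (univ : Finset α).powerset, (if univ \ a.1 ⊆ R ∧ R ⊆ b.1 ∧ univ \ R ∈ G then (1 : ZMod 2) else 0)
  let Δm : Matrix J J (ZMod 2) := fun b a =>
    ∑ C ∈ (univ : Finset α).powerset, (if C ∈ G ∧ univ \ a.1 ⊆ C ∧ C ⊆ b.1 then (1 : ZMod 2) else 0)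
  have hΓΔ : Γm * Δm = 1 := by
    ext a a'
    rw [Matrix.mul_apply, Matrix.one_apply]
    have h := gam_del_sum hG (univ : Finset α) (sdiff_mem_outV_of_mem_inV a.2) (sdiff_mem_outV_of_mem_inV a'.2)
    rw [← Finset.sum_coe_sort J] at h
    rw [h]
    by_cases haa : a = a'
    · subst haa; simp
    · rw [if_neg, if_neg haa]
      intro h'
      apply haa
      apply Subtype.ext
      have := congrArg (fun s => (univ : Finset α) \ s) h'
      simp only [Finset.sdiff_sdiff_eq_self (subset_univ _)] at this
      exact this
  have hΔΓ : Δm * Γm = 1 := mul_eq_one_comm.1 hΓΔ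
  have h := congrFun (congrFun hΔΓ ⟨S, hS⟩) ⟨S'', hS''⟩
  rw [Matrix.mul_apply, Matrix.one_apply] at h
  rw [← Finset.sum_coe_sort J]
  rw [h]
  by_cases hSS : S = S''
  · subst hSS; simp
  · rw [if_neg hSS, if_neg]
    intro h'; exact hSS (congrArg Subtype.val h')

/-! ## 2. Sunflower bookkeeping: the up-sets `G_c = K ∪ petal_c`, sources, targets -/

section Sunflower

variable (K D : Finset (Finset α)) (ρ : Finset α → ℕ)

/-- `G_c = K ∪ {x ∉ D : ρ x = c}` is an up-set (uses only that `K` is up, `D` is down and `ρ` is constant along middle inclusions). [this work] -/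
theorem isUpperSet_G (hK : IsUpperSet (K : Set (Finset α))) (hD : IsLowerSet (D : Set (Finset α)))
    (hρ : ∀ s t : Finset α, s ⊆ t → s ∉ D → t ∉ K → ρ s = ρ t) (c : ℕ) :
    IsUpperSet (((univ : Finset (Finset α)).filter fun x => x ∈ K ∨ (x ∉ D ∧ ρ x = c) : Finset (Finset α)) : Set (Finset α)) := by
  intro a b hab ha
  rw [Finset.mem_coe, mem_filter] at ha ⊢
  refine ⟨mem_univ _, ?_⟩
  rcases ha.2 with haK | ⟨haD, hac⟩
  · exact Or.inl (hK hab haK)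
  · by_cases hbK : b ∈ K
    · exact Or.inl hbK
    · refine Or.inr ⟨fun hbD => haD (hD hab hbD), ?_⟩
      rw [← hρ a b hab haD hbK]; exact hac

/-- Membership in `G_c`. [this work] -/
theorem mem_G_iff (c : ℕ) (x : Finset α) :
    x ∈ ((univ : Finset (Finset α)).filter fun x => x ∈ K ∨ (x ∉ D ∧ ρ x = c)) ↔ x ∈ K ∨ (x ∉ D ∧ ρ x = c) := by
  rw [mem_filter]; exact ⟨fun h => h.2, fun h => ⟨mem_univ _, h⟩⟩

/-- A target `t` (`t ∈ K`, `univ∖t ∈ D`) lies in `IN(G_c)` for every `c`. [this work] -/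
theorem mem_inV_G_of_target (hKD : Disjoint K D) (c : ℕ) {t : Finset α} (htK : t ∈ K) (htD : univ \ t ∈ D) :
    t ∈ inV ((univ : Finset (Finset α)).filter fun x => x ∈ K ∨ (x ∉ D ∧ ρ x = c)) univ := by
  unfold inV
  rw [mem_filter, mem_powerset, mem_G_iff, mem_G_iff]
  refine ⟨subset_univ _, Or.inl htK, ?_⟩
  rintro (h | ⟨h, -⟩)
  · exact (Finset.disjoint_left.1 hKD) h htD
  · exact h htD

/-- The complement of a source `s` (middle/middle pair with `ρ s < ρ (univ∖s)`) lies in `IN(G_c)` for `c = ρ (univ∖s)`. [this work] -/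
theorem compl_mem_inV_G_of_source {s : Finset α} (hsK : s ∉ K) (hscD : univ \ s ∉ D) (hlt : ρ s < ρ (univ \ s)) :
    univ \ s ∈ inV ((univ : Finset (Finset α)).filter fun x => x ∈ K ∨ (x ∉ D ∧ ρ x = ρ (univ \ s))) univ := by
  unfold inV
  rw [mem_filter, mem_powerset, mem_G_iff, mem_G_iff, Finset.sdiff_sdiff_eq_self (subset_univ s)]
  refine ⟨sdiff_subset, Or.inr ⟨hscD, rfl⟩, ?_⟩
  rintro (h | ⟨-, h⟩)
  · exact hsK h
  · exact absurd h (ne_of_lt hlt)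

/-- **Vanishing of a source row off the target columns.**  For a source `s` with head `c = ρ (univ∖s)` and `a ∈ IN(G_c)` that is NOT a target,
the entry `δ_{G_c}(univ∖s, univ∖a)` vanishes — indeed no `C` with `univ∖a ⊆ C ⊆ univ∖s` exists (petal bookkeeping). [this work] -/
theorem row_entry_eq_zero_of_not_target
    (hρ : ∀ s t : Finset α, s ⊆ t → s ∉ D → t ∉ K → ρ s = ρ t)
    {s : Finset α} (hsD : s ∉ D) (hscK : univ \ s ∉ K) (hlt : ρ s < ρ (univ \ s))
    {a : Finset α} (ha : a ∈ inV ((univ : Finset (Finset α)).filter fun x => x ∈ K ∨ (x ∉ D ∧ ρ x = ρ (univ \ s))) univ)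
    (hna : ¬ (a ∈ K ∧ univ \ a ∈ D)) :
    (∑ C ∈ (univ : Finset α).powerset,
        (if C ∈ ((univ : Finset (Finset α)).filter fun x => x ∈ K ∨ (x ∉ D ∧ ρ x = ρ (univ \ s))) ∧ univ \ a ⊆ C ∧ C ⊆ univ \ s
          then (1 : ZMod 2) else 0)) = 0 := by
  -- it suffices that `univ \ a ⊆ univ \ s` is impossible
  have key : ¬ (univ \ a ⊆ univ \ s) := by
    intro hsub
    unfold inV at ha
    rw [mem_filter, mem_G_iff, mem_G_iff] at ha
    obtain ⟨-, haG, hacG⟩ := ha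
    by_cases haK : a ∈ K
    · have hacD : univ \ a ∉ D := fun h => hna ⟨haK, h⟩
      have hne : ρ (univ \ a) ≠ ρ (univ \ s) := fun h => hacG (Or.inr ⟨hacD, h⟩)
      exact hne (hρ _ _ hsub hacD hscK)
    · rcases haG with h | ⟨haD, hac⟩
      · exact haK h
      · have hsa : s ⊆ a := by
          intro x hx
          by_contra hxa
          have : x ∈ univ \ s := hsub (mem_sdiff.2 ⟨mem_univ x, hxa⟩)
          exact (mem_sdiff.1 this).2 hx
        have := hρ s a hsa hsD haK
        rw [hac] at this
        exact absurd this (ne_of_lt hlt)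
  refine sum_eq_zero fun C _ => ?_
  rw [if_neg]
  rintro ⟨-, h1, h2⟩
  exact key (h1.trans h2)

/-- **(F1) Same head: the Gram entry is `[s = s₀]`.**  For sources `s, s₀` with the same head `c = ρ(univ∖s) = ρ(univ∖s₀)`:
`Σ_{t target} δ_{G_c}(univ∖s, univ∖t) · γ_{G_c}(univ∖t, univ∖s₀) = [s = s₀]` over `GF(2)` (from `del_gam_sum` and the vanishing of the row off the
target columns). [this work] -/
theorem gram_same_head (hK : IsUpperSet (K : Set (Finset α))) (hD : IsLowerSet (D : Set (Finset α))) (hKD : Disjoint K D)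
    (hρ : ∀ s t : Finset α, s ⊆ t → s ∉ D → t ∉ K → ρ s = ρ t) (c : ℕ)
    {s : Finset α} (hsK : s ∉ K) (hsD : s ∉ D) (hscK : univ \ s ∉ K) (hscD : univ \ s ∉ D) (hlt : ρ s < ρ (univ \ s)) (hs : ρ (univ \ s) = c)
    {s₀ : Finset α} (hs₀K : s₀ ∉ K) (hs₀cD : univ \ s₀ ∉ D) (hlt₀ : ρ s₀ < ρ (univ \ s₀)) (hs₀ : ρ (univ \ s₀) = c) :
    (∑ t ∈ (univ : Finset α).powerset.filter (fun t => t ∈ K ∧ univ \ t ∈ D),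
        (∑ C ∈ (univ : Finset α).powerset,
            (if C ∈ ((univ : Finset (Finset α)).filter fun x => x ∈ K ∨ (x ∉ D ∧ ρ x = c)) ∧ univ \ t ⊆ C ∧ C ⊆ univ \ s
              then (1 : ZMod 2) else 0)) *
        (∑ R ∈ (univ : Finset α).powerset,
            (if univ \ t ⊆ R ∧ R ⊆ univ \ s₀ ∧ univ \ R ∈ ((univ : Finset (Finset α)).filter fun x => x ∈ K ∨ (x ∉ D ∧ ρ x = c))
              then (1 : ZMod 2) else 0)))
      = if s = s₀ then 1 else 0 := by
  set G := ((univ : Finset (Finset α)).filter fun x => x ∈ K ∨ (x ∉ D ∧ ρ x = c)) with hGdef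
  have hG : IsUpperSet (G : Set (Finset α)) := isUpperSet_G K D ρ hK hD hρ c
  have hS : univ \ s ∈ inV G univ := by have := compl_mem_inV_G_of_source K D ρ hsK hscD hlt; rw [hs] at this; exact this
  have hS₀ : univ \ s₀ ∈ inV G univ := by have := compl_mem_inV_G_of_source K D ρ hs₀K hs₀cD hlt₀; rw [hs₀] at this; exact this
  have h := del_gam_sum hG hS hS₀
  have hsub : (univ : Finset α).powerset.filter (fun t => t ∈ K ∧ univ \ t ∈ D) ⊆ inV G univ := by
    intro t ht
    rw [mem_filter] at ht
    exact mem_inV_G_of_target K D ρ hKD c ht.2.1 ht.2.2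
  rw [Finset.sum_subset hsub ?van]
  case van =>
    intro a ha hna
    rw [mem_filter, not_and, mem_powerset] at hna
    have hna' : ¬ (a ∈ K ∧ univ \ a ∈ D) := fun h' => hna (subset_univ a) h'
    have hz := row_entry_eq_zero_of_not_target K D ρ hρ hsD hscK hlt (by rw [hs]; exact ha) hna'
    rw [hs] at hz
    rw [hz, zero_mul]
  rw [h]
  by_cases hss : s = s₀
  · subst hss; simp
  · rw [if_neg hss, if_neg]
    intro h'
    apply hss
    have := congrArg (fun x => (univ : Finset α) \ x) h'
    simp only [Finset.sdiff_sdiff_eq_self (subset_univ _)] at this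
    exact this

end Sunflower

end Summit.CriticalPhenomena.PercolationContinuityZ3.Theorems.JBern
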